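import Literature.MathematicalPhysics.QuantumFieldTheory.Balaban1983to89.B7Eq42NotEuclideanSymmetric

/-!
# [Balaban1987RG1] p. 252 for the tree's (42), PARAMETRIC: Bałaban's block average (42) of [Balaban1985Averaging]
# (`B7Prop1Explicit.bavg L`) is not equivariant under the transposition of the first two axes of `ℤ^d` for EVERY
# dimension `d ≥ 2` and EVERY block size `L ≥ 2` — in particular at the four-dimensional, `L > 11` parameters of the
# tree's `T4Continuum.T4Family`

Companion of `B7Eq42NotEuclideanSymmetric` (the `d = 2`, `L = 2` certificate by `decide`; cell `pub-ymgap`, seat `pub-ymgap-dag-n16-w3`), same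
printed sentence: [Balaban1987RG1] p. 252 «In the previous papers we have used the definition introduced in [12]. This definition has one
disadvantage, it is not symmetric with respect to lattice Euclidean transformations.»  Here the traversal counts are computed by HAND for all
`(d, L)`: §1 bookkeeping for `B7Eq42NotEuclideanSymmetric.passes` (additivity over concatenation; a word with no letter along the defect's axis,
or no letter moving an axis in which the start differs from the defect, never meets it; a straight run through ∕ past the defect) and the
splitting `treeWord v = twRest v ++ seg 0 (v 0)` of the tree contour of [Balaban1984PropagatorsI] (1.7) (the tree's `B7Prop1Explicit.treeWord`
changes the LAST coordinate first and the coordinate `0` LAST); §2 the witness on `ℤ^{d+2}`, `L ≥ 2`, phase `g = e^{i/2} ∈ U(1)`: the defect on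
the `e₁`-bond at the site `e₀` is met by NO (42)-loop of the coarse bond `⟨0, L e₀⟩` (`passes_sideA`: the `e₁`-steps of those loops sit at
`x₀ ∈ {0, L} ∌ 1`), so `V̄ = 1` there (`bavg_VdefG`); after transposing the axes the defect is the `e₀`-bond at `e₁` and, among the loops of the
transposed bond `⟨0, L e₁⟩`, exactly those through the block points `(t, 1, 0, …, 0)`, `1 ≤ t < L`, meet it, once, forward (`passes_sideB`), so
`V̄ = exp((M∕L^{d+2}) log g)` with `1 ≤ M ≤ L^{d+2}` such points (`val_bavg_permCfg_VdefG`) and `V̄ ≠ 1`; hence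
**`not_permEquivariant_bavg_general`**: `¬ PermEquivariantAt (bavg L) (Equiv.swap 0 1)` on `ℤ^{d+2}` for every `d` and every `L ≥ 2`, and
`not_permEquivariant_bavg_dim4` (`d + 2 = 4`).  The axis action is lit-balaban's `B12Average012Permutation.permSite ∕ permCfg`, under which
[I]'s own (0.11)∕(0.12) average IS covariant (`B12Average012Permutation.avgBar_permE`).

HONEST FRAMING.  A kernel certificate of one printed sentence for the tree's typed (42), uniform in the parameters; scalar (`U(1) ⊂ ℂ`) valued
configurations; nothing of (0.4)'s or Bałaban's estimates is asserted; no bearing on any node count, the continuum limit, OS, a mass gap or Clay.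
No `sorry`, no `instance`, no `notation`.
-/

noncomputable section

open scoped BigOperators
open NormedSpace

namespace Literature.MathematicalPhysics.QuantumFieldTheory.Balaban1983to89.B7Eq42NotEuclideanSymmetricGeneral

open B7Prop1Explicit MatrixLog B7BlockAvgLog
open B12Average012Permutation (permSite permCfg permSite_apply permCfg_apply permSite_e permSite_inv_permSite)
open B7Eq42NotEuclideanSymmetric (PermEquivariantAt defectCfg passes hol_defectCfg gph mlog_gph)

variable {d : ℕ}

/-! ## §1 Bookkeeping for the traversal count `passes` and the splitting of the tree contour -/

section Passes

/-- `passes` is additive over concatenation (the second word read from the end point of the first). [cite: Balaban1985Averaging, (9) p.18 (bookkeeping)] -/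
theorem passes_append (x₀ : B7Prop1Explicit.Site d) (κ₀ : Fin d) : ∀ (x : B7Prop1Explicit.Site d) (w₁ w₂ : List (Letter d)),
    passes x₀ κ₀ x (w₁ ++ w₂) = passes x₀ κ₀ x w₁ + passes x₀ κ₀ (x + disp w₁) w₂
  | x, [], w₂ => by simp [passes]
  | x, l :: w₁, w₂ => by
    rw [List.cons_append, passes, passes, passes_append x₀ κ₀ (x + l.vec) w₁ w₂, disp_cons, add_assoc, add_assoc]

/-- A word with NO letter along the defect's axis never meets the defect bond. [cite: Balaban1985Averaging, (9) p.18 (bookkeeping)] -/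
theorem passes_eq_zero_of_forall_fst_ne (x₀ : B7Prop1Explicit.Site d) (κ₀ : Fin d) :
    ∀ (x : B7Prop1Explicit.Site d) (w : List (Letter d)), (∀ l ∈ w, l.1 ≠ κ₀) → passes x₀ κ₀ x w = 0
  | x, [], _ => by simp [passes]
  | x, l :: w, h => by
    have hl : l.1 ≠ κ₀ := h l (by simp)
    rw [passes, if_neg hl, zero_add]
    exact passes_eq_zero_of_forall_fst_ne x₀ κ₀ (x + l.vec) w (fun l' hl' => h l' (by simp [hl']))

/-- A letter that does not move axis `j` has `j`-component `0`. [folklore] -/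
private theorem vec_apply_eq_zero_of_fst_ne {l : Letter d} {j : Fin d} (hl : l.1 ≠ j) : l.vec j = 0 := by
  obtain ⟨μ, b⟩ := l
  have hj : j ≠ μ := fun h => hl (h ▸ rfl)
  cases b <;> simp [Letter.vec, e_apply, hj]

/-- A word none of whose letters moves axis `j`, started at a site differing from the defect site in coordinate `j`, never meets the defect
bond (every position keeps the starting `j`-coordinate). [cite: Balaban1985Averaging, (9) p.18 (bookkeeping)] -/
theorem passes_eq_zero_of_coord (x₀ : B7Prop1Explicit.Site d) (κ₀ j : Fin d) :
    ∀ (x : B7Prop1Explicit.Site d) (w : List (Letter d)), (∀ l ∈ w, l.1 ≠ j) → x j ≠ x₀ j → passes x₀ κ₀ x w = 0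
  | x, [], _, _ => by simp [passes]
  | x, l :: w, hw, hx => by
    have hl : l.1 ≠ j := hw l (by simp)
    have hx' : (x + l.vec) j ≠ x₀ j := by
      rw [Pi.add_apply, vec_apply_eq_zero_of_fst_ne hl, add_zero]; exact hx
    have hne : x ≠ x₀ := fun h => hx (by rw [h])
    have hne' : x + l.vec ≠ x₀ := fun h => hx' (by rw [h])
    have h0 : (if l.1 = κ₀ then (if l.2 then (if x = x₀ then (1 : ℤ) else 0) else (if x + l.vec = x₀ then -1 else 0)) else 0) = 0 := by
      simp [hne, hne']
    rw [passes, h0, zero_add]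
    exact passes_eq_zero_of_coord x₀ κ₀ j (x + l.vec) w (fun l' hl' => hw l' (by simp [hl'])) hx'

/-- A straight forward run along the defect's axis started strictly PAST the defect site never meets it. [cite: Balaban1985Averaging, (9) p.18 (bookkeeping)] -/
theorem passes_replicate_true_of_lt (x₀ : B7Prop1Explicit.Site d) (κ₀ : Fin d) :
    ∀ (n : ℕ) (x : B7Prop1Explicit.Site d), x₀ κ₀ < x κ₀ → passes x₀ κ₀ x (List.replicate n (κ₀, true)) = 0
  | 0, x, _ => by simp [passes]
  | n + 1, x, hx => by
    have hne : x ≠ x₀ := fun h => by rw [h] at hx; exact lt_irrefl _ hx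
    have hc : (if ((κ₀, true) : Letter d).1 = κ₀ then (if ((κ₀, true) : Letter d).2 then (if x = x₀ then (1 : ℤ) else 0)
        else (if x + Letter.vec (κ₀, true) = x₀ then -1 else 0)) else 0) = 0 := by simp [hne]
    rw [List.replicate_succ, passes, hc, zero_add]
    refine passes_replicate_true_of_lt x₀ κ₀ n _ ?_
    rw [Letter.vec_true, Pi.add_apply, e_apply, if_pos rfl]
    omega

/-- A straight forward run along the defect's axis STARTED AT the defect site meets it exactly once (`n ≥ 1`). [cite: Balaban1985Averaging, (9) p.18 (bookkeeping)] -/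
theorem passes_replicate_true_self (x₀ : B7Prop1Explicit.Site d) (κ₀ : Fin d) (n : ℕ) :
    passes x₀ κ₀ x₀ (List.replicate n (κ₀, true)) = if n = 0 then 0 else 1 := by
  cases n with
  | zero => simp [passes]
  | succ n =>
    have hc : (if ((κ₀, true) : Letter d).1 = κ₀ then (if ((κ₀, true) : Letter d).2 then (if x₀ = x₀ then (1 : ℤ) else 0)
        else (if x₀ + Letter.vec (κ₀, true) = x₀ then -1 else 0)) else 0) = 1 := by simp
    rw [List.replicate_succ, passes, hc, passes_replicate_true_of_lt x₀ κ₀ n _ (by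
      rw [Letter.vec_true, Pi.add_apply, e_apply, if_pos rfl]; omega)]
    simp

/-- Every letter of a reversed word has the axis of a letter of the word. [folklore] -/
private theorem exists_fst_eq_of_mem_revWord {w : List (Letter d)} {l : Letter d} (h : l ∈ revWord w) : ∃ l' ∈ w, l'.1 = l.1 := by
  simp only [revWord, List.mem_reverse, List.mem_map] at h
  obtain ⟨l', hl', rfl⟩ := h
  exact ⟨l', hl', rfl⟩

/-- THE TREE CONTOUR WITHOUT ITS LAST RUN: the runs of `Γ_{0,v}` ([Balaban1984PropagatorsI] (1.7), the tree's `treeWord`) along the axes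
`d, d−1, …, 1` — all but the final run along the axis `0`. [cite: Balaban1985Averaging, p.24 (bookkeeping)] -/
def twRest (v : B7Prop1Explicit.Site (d + 1)) : List (Letter (d + 1)) :=
  ((List.finRange d).map Fin.succ).reverse.flatMap fun κ => seg κ (v κ)

/-- `Γ_{0,v}` = (the runs along the axes `d, …, 1`) followed by (the run along the axis `0`). [cite: Balaban1985Averaging, p.24 (bookkeeping)] -/
theorem treeWord_eq_twRest_append (v : B7Prop1Explicit.Site (d + 1)) : treeWord v = twRest v ++ seg 0 (v 0) := by
  rw [treeWord, List.finRange_succ, List.reverse_cons, List.flatMap_append]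
  simp [twRest]

/-- No letter of `twRest v` moves the axis `0`. [cite: Balaban1985Averaging, p.24 (bookkeeping)] -/
theorem fst_ne_zero_of_mem_twRest (v : B7Prop1Explicit.Site (d + 1)) {l : Letter (d + 1)} (hl : l ∈ twRest v) : l.1 ≠ 0 := by
  simp only [twRest, List.mem_flatMap, List.mem_reverse, List.mem_map, List.mem_finRange, true_and] at hl
  obtain ⟨κ, ⟨i, rfl⟩, hl⟩ := hl
  rw [mem_seg hl]
  exact Fin.succ_ne_zero i

/-- The end point of `twRest v` is `v` with its `0`-th coordinate removed. [cite: Balaban1985Averaging, p.24 (bookkeeping)] -/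
theorem disp_twRest (v : B7Prop1Explicit.Site (d + 1)) : disp (twRest v) = v - (v 0) • e 0 := by
  have h := disp_treeWord v
  rw [treeWord_eq_twRest_append, disp_append, disp_seg] at h
  exact eq_sub_of_add_eq h

end Passes

/-! ## §2 The witness on `ℤ^{d+2}`, every `L ≥ 2` -/

section Witness

variable (d)

/-- The transposition of the axes `0` and `1` of `ℤ^{d+2}`. [folklore] -/
def σ01 : Equiv.Perm (Fin (d + 2)) := Equiv.swap 0 1

/-- THE CONFIGURATION: the defect `g = e^{i/2}` on the `e₁`-bond at the site `e₀` (inside the corner block of `0` for `L ≥ 2`, off the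
corner line `x₀ = 0`). [folklore] -/
def VdefG : B7Prop1Explicit.Site (d + 2) → Fin (d + 2) → ℂˣ := defectCfg (e 0) 1 gph

variable {d}

/-- The transposed configuration: the defect on the `e₀`-bond at the site `e₁`. [cite: Balaban1987RG1, (2.17) p.269 (bookkeeping)] -/
theorem permCfg_σ01_VdefG : permCfg (σ01 d) (VdefG d) = defectCfg (e 1) 0 gph := by
  funext x μ
  rw [permCfg_apply, VdefG, defectCfg, defectCfg]
  have hx : permSite (σ01 d) x = e 0 ↔ x = e 1 := by
    constructor
    · intro h
      have := congrArg (permSite (σ01 d)⁻¹) h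
      rw [permSite_inv_permSite, permSite_e] at this
      rw [this]; simp [σ01]
    · rintro rfl
      rw [permSite_e]; simp [σ01]
  have hμ : (σ01 d) μ = 1 ↔ μ = 0 := by
    rw [σ01]
    constructor
    · intro h
      have := congrArg (Equiv.swap (0 : Fin (d + 2)) 1) h
      simpa using this
    · rintro rfl; simp
  simp only [hx, hμ]

/-! ### Side A: no (42)-loop of `⟨0, L e₀⟩` meets the `e₁`-defect at `e₀` -/

/-- SIDE A traversal count: zero for every block point, and zero for the straight transporter. [cite: Balaban1985Averaging, (42) p.23 (bookkeeping)] -/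
theorem passes_sideA {L : ℕ} (hL : 2 ≤ L) (r : Fin (d + 2) → Fin L) :
    passes (e 0) 1 0 (gammaWord L 0 (boxVec L r)) = 0 ∧
      passes (e 0) 1 (0 : B7Prop1Explicit.Site (d + 2)) (seg 0 ((L : ℕ) : ℤ)) = 0 := by
  have hseg : ∀ (n : ℤ) (x : B7Prop1Explicit.Site (d + 2)), passes (e 0) 1 x (seg 0 n) = 0 := fun n x =>
    passes_eq_zero_of_forall_fst_ne _ _ x _ (fun l hl => by rw [mem_seg hl]; exact Fin.zero_ne_one)
  refine ⟨?_, hseg _ _⟩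
  rw [gammaWord, passes_append, passes_append, treeWord_eq_twRest_append, passes_append, revWord_append, passes_append]
  -- the four pieces: twRest (no axis-0 letter, start at x₀ = 0 ≠ 1), the axis-0 run, the middle segment, the reversed axis-0 run: all 0;
  -- the reversed twRest: no axis-0 letter, start at x₀ = L ≠ 1
  have h1 : passes (e 0) 1 0 (twRest (boxVec L r)) = 0 :=
    passes_eq_zero_of_coord _ _ 0 _ _ (fun l hl => fst_ne_zero_of_mem_twRest _ hl) (by simp [e_apply])
  have h4 : ∀ x : B7Prop1Explicit.Site (d + 2), passes (e 0) 1 x (revWord (seg (0 : Fin (d + 2)) (boxVec L r 0))) = 0 := fun x => by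
    rw [revWord_seg]; exact hseg _ _
  have h5 : ∀ x : B7Prop1Explicit.Site (d + 2), x 0 = (L : ℤ) → passes (e 0) 1 x (revWord (twRest (boxVec L r))) = 0 := fun x hx =>
    passes_eq_zero_of_coord _ _ 0 _ _
      (fun l hl => by obtain ⟨l', hl', h'⟩ := exists_fst_eq_of_mem_revWord hl; rw [← h']; exact fst_ne_zero_of_mem_twRest _ hl')
      (by rw [hx, e_apply, if_pos rfl]; exact_mod_cast (by omega : L ≠ 1))
  rw [h1, hseg, hseg, h4, h5 _ ?_]
  · simp
  · simp only [disp_append, disp_twRest, disp_seg, disp_revWord, Pi.add_apply, Pi.sub_apply, Pi.smul_apply, Pi.neg_apply,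
      Pi.zero_apply, e_apply, smul_eq_mul, boxVec]
    simp

/-- Hence every (42)-loop variable of `VdefG` at `⟨0, L e₀⟩` is `1` … [cite: Balaban1985Averaging, (42) p.23 (bookkeeping)] -/
theorem Wcx_VdefG {L : ℕ} (hL : 2 ≤ L) (r : Fin (d + 2) → Fin L) : Wcx L (VdefG d) 0 0 (boxVec L r) = 1 := by
  obtain ⟨h1, h2⟩ := passes_sideA (d := d) hL r
  rw [Wcx, VdefG, hol_defectCfg, hol_defectCfg, h1, h2]
  simp

/-- … **SIDE A**: `V̄ = 1` for `VdefG` at `⟨0, L e₀⟩`. [cite: Balaban1985Averaging, (42) p.23 (bookkeeping)] -/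
theorem bavg_VdefG {L : ℕ} (hL : 2 ≤ L) : bavg L (VdefG d) 0 0 = 1 := by
  have hX : Xavg L (VdefG d) 0 0 = 0 := by simp [Xavg, Wcx_VdefG hL, mlog_one]
  show expUnit (Xavg L (VdefG d) 0 0) * hol (VdefG d) 0 (seg 0 ((L : ℕ) : ℤ)) = 1
  rw [hX, VdefG, hol_defectCfg, (passes_sideA (d := d) hL fun _ => ⟨0, by omega⟩).2, zpow_zero, mul_one]
  exact Units.ext (by simp)

/-! ### Side B: the loops of the transposed bond `⟨0, L e₁⟩` through `(t, 1, 0, …, 0)`, `t ≥ 1`, meet the transposed defect once -/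

/-- The block points whose (42)-loop of `⟨0, L e₁⟩` meets the `e₀`-bond at `e₁`: `(t, 1, 0, …, 0)` with `t ≥ 1`. [cite: Balaban1985Averaging, (42) p.23 (bookkeeping)] -/
abbrev MeetsB (L : ℕ) (r : Fin (d + 2) → Fin L) : Prop :=
  boxVec L r - (boxVec L r 0) • e 0 = e 1 ∧ (r 0 : ℕ) ≠ 0

/-- SIDE B traversal count: `1` at the block points of `MeetsB`, `0` elsewhere; `0` for the straight transporter. [cite: Balaban1985Averaging, (42) p.23 (bookkeeping)] -/
theorem passes_sideB {L : ℕ} (hL : 2 ≤ L) (r : Fin (d + 2) → Fin L) :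
    passes (e 1) 0 0 (gammaWord L 1 (boxVec L r)) = (if MeetsB L r then 1 else 0) ∧
      passes (e 1) 0 (0 : B7Prop1Explicit.Site (d + 2)) (seg 1 ((L : ℕ) : ℤ)) = 0 := by
  have hseg1 : ∀ (n : ℤ) (x : B7Prop1Explicit.Site (d + 2)), passes (e 1) 0 x (seg 1 n) = 0 := fun n x =>
    passes_eq_zero_of_forall_fst_ne _ _ x _ (fun l hl => by rw [mem_seg hl]; exact Fin.zero_ne_one.symm)
  refine ⟨?_, hseg1 _ _⟩
  rw [gammaWord, passes_append, passes_append, treeWord_eq_twRest_append, passes_append, revWord_append, passes_append]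
  -- twRest: no axis-0 letter ⇒ 0
  have h1 : ∀ x : B7Prop1Explicit.Site (d + 2), passes (e 1) 0 x (twRest (boxVec L r)) = 0 := fun x =>
    passes_eq_zero_of_forall_fst_ne _ _ x _ (fun l hl => fst_ne_zero_of_mem_twRest _ hl)
  -- the axis-0 run from `p* = r − r₀e₀`
  have h2 : passes (e 1) 0 (boxVec L r - (boxVec L r 0) • e 0) (seg (0 : Fin (d + 2)) (boxVec L r 0)) = if MeetsB L r then 1 else 0 := by
    rw [show seg (0 : Fin (d + 2)) (boxVec L r 0) = List.replicate (r 0 : ℕ) (0, true) from seg_natCast 0 (r 0)]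
    by_cases hp : boxVec L r - boxVec L r 0 • e 0 = e 1
    · have hrun : passes (e 1) 0 (boxVec L r - boxVec L r 0 • e 0) (List.replicate (r 0 : ℕ) (0, true)) =
          if (r 0 : ℕ) = 0 then 0 else 1 := by
        rw [hp]; exact passes_replicate_true_self _ _ _
      rw [hrun]
      by_cases h0 : (r 0 : ℕ) = 0
      · rw [if_pos h0, if_neg (fun h => h.2 h0)]
      · rw [if_neg h0, if_pos ⟨hp, h0⟩]
    · obtain ⟨j, hj⟩ := Function.ne_iff.mp hp
      have hj0 : j ≠ 0 := by
        rintro rfl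
        apply hj
        simp [boxVec, e_apply]
      rw [passes_eq_zero_of_coord _ _ j _ _ (fun l hl => by rw [(List.eq_of_mem_replicate hl : l = (0, true))]; exact hj0.symm) hj,
        if_neg (fun h => hp h.1)]
  -- the reversed axis-0 run from `r + L e₁`: no letter moves axis 1, start has x₁ = r₁ + L ≠ 1
  have h4 : passes (e 1) 0 (boxVec L r + ((L : ℕ) : ℤ) • e 1) (revWord (seg (0 : Fin (d + 2)) (boxVec L r 0))) = 0 := by
    rw [revWord_seg, show boxVec L r 0 = ((r 0 : ℕ) : ℤ) from rfl, seg_neg_natCast]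
    refine passes_eq_zero_of_coord _ _ 1 _ _ (fun l hl => by rw [(List.eq_of_mem_replicate hl : l = (0, false))]; exact Fin.zero_ne_one) ?_
    rw [Pi.add_apply, Pi.smul_apply, e_apply, if_pos rfl, smul_eq_mul, mul_one]
    show ((r 1 : ℕ) : ℤ) + (L : ℤ) ≠ 1
    omega
  -- the reversed twRest: no axis-0 letter ⇒ 0
  have h5 : ∀ x : B7Prop1Explicit.Site (d + 2), passes (e 1) 0 x (revWord (twRest (boxVec L r))) = 0 := fun x =>
    passes_eq_zero_of_forall_fst_ne _ _ x _
      (fun l hl => by obtain ⟨l', hl', h'⟩ := exists_fst_eq_of_mem_revWord hl; rw [← h']; exact fst_ne_zero_of_mem_twRest _ hl')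
  simp only [h1, zero_add, disp_twRest, h2, hseg1, add_zero, h5]
  have hpos : disp (twRest (boxVec L r) ++ seg 0 (boxVec L r 0) ++ seg 1 ((L : ℕ) : ℤ)) = boxVec L r + ((L : ℕ) : ℤ) • e 1 := by
    rw [disp_append, disp_append, disp_twRest, disp_seg, disp_seg, sub_add_cancel]
  rw [hpos, h4, add_zero]

/-- The loop variables of the transposed configuration at `⟨0, L e₁⟩`: `g` on `MeetsB`, `1` elsewhere. [cite: Balaban1985Averaging, (42) p.23 (bookkeeping)] -/
theorem Wcx_permCfg_VdefG {L : ℕ} (hL : 2 ≤ L) (r : Fin (d + 2) → Fin L) :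
    Wcx L (permCfg (σ01 d) (VdefG d)) 0 1 (boxVec L r) = if MeetsB L r then gph else 1 := by
  obtain ⟨h1, h2⟩ := passes_sideB (d := d) hL r
  rw [permCfg_σ01_VdefG, Wcx, hol_defectCfg, hol_defectCfg, h1, h2]
  split_ifs <;> simp

/-- The number `M` of block points in `MeetsB` is at least `1` (the point `(1, 1, 0, …, 0)`, `L ≥ 2`) … [cite: Balaban1985Averaging, (42) p.23 (bookkeeping)] -/
theorem one_le_card_meetsB {L : ℕ} (hL : 2 ≤ L) : 1 ≤ (Finset.univ.filter (MeetsB (d := d) L)).card := by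
  refine Finset.card_pos.mpr ⟨fun κ => if κ = 0 ∨ κ = 1 then ⟨1, by omega⟩ else ⟨0, by omega⟩, ?_⟩
  rw [Finset.mem_filter]
  refine ⟨Finset.mem_univ _, ?_, by simp⟩
  funext κ
  simp only [boxVec, Pi.sub_apply, Pi.smul_apply, e_apply, smul_eq_mul]
  by_cases h0 : κ = 0
  · subst h0; simp
  · by_cases h1 : κ = 1
    · subst h1; simp
    · simp [h0, h1]

/-- … and at most `L^{d+2}` (all block points). [cite: Balaban1985Averaging, (42) p.23 (bookkeeping)] -/
theorem card_meetsB_le {L : ℕ} :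
    (Finset.univ.filter (MeetsB (d := d) L)).card ≤ L ^ (d + 2) := by
  calc (Finset.univ.filter (MeetsB (d := d) L)).card ≤ (Finset.univ : Finset (Fin (d + 2) → Fin L)).card := Finset.card_filter_le _ _
    _ = L ^ (d + 2) := by simp

/-- The exponent (42) of the transposed configuration at `⟨0, L e₁⟩`: `(M ∕ L^{d+2}) · log g`. [cite: Balaban1985Averaging, (42) p.23 (bookkeeping)] -/
theorem Xavg_permCfg_VdefG {L : ℕ} (hL : 2 ≤ L) :
    Xavg L (permCfg (σ01 d) (VdefG d)) 0 1 =
      (((Finset.univ.filter (MeetsB (d := d) L)).card : ℝ) * (((L : ℝ) ^ (d + 2))⁻¹)) • ((2 : ℂ)⁻¹ * Complex.I) := by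
  unfold Xavg
  have hterm : ∀ r : Fin (d + 2) → Fin L,
      (((L : ℝ) ^ (d + 2))⁻¹) • mlog ((Wcx L (permCfg (σ01 d) (VdefG d)) 0 1 (boxVec L r) : ℂˣ) : ℂ) =
        if MeetsB L r then (((L : ℝ) ^ (d + 2))⁻¹) • ((2 : ℂ)⁻¹ * Complex.I) else 0 := by
    intro r
    rw [Wcx_permCfg_VdefG hL]
    split_ifs <;> simp [mlog_gph]
  rw [Finset.sum_congr rfl (fun r _ => hterm r), Finset.sum_ite, Finset.sum_const_zero, add_zero, Finset.sum_const,
    ← Nat.cast_smul_eq_nsmul ℝ, smul_smul]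

/-- **SIDE B**: `V̄ = exp(s·i)` with `s = M∕(2L^{d+2}) ∈ (0, 1∕2]` for the transposed configuration at `⟨0, L e₁⟩`. [cite: Balaban1985Averaging, (42) p.23 (bookkeeping)] -/
theorem val_bavg_permCfg_VdefG {L : ℕ} (hL : 2 ≤ L) :
    ((bavg L (permCfg (σ01 d) (VdefG d)) 0 1 : ℂˣ) : ℂ) =
      Complex.exp ((((Finset.univ.filter (MeetsB (d := d) L)).card : ℝ) * (((L : ℝ) ^ (d + 2))⁻¹) * 2⁻¹ : ℝ) * Complex.I) := by
  show ((expUnit (Xavg L (permCfg (σ01 d) (VdefG d)) 0 1) * hol (permCfg (σ01 d) (VdefG d)) 0 (seg 1 ((L : ℕ) : ℤ)) : ℂˣ) : ℂ) = _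
  rw [Xavg_permCfg_VdefG hL, permCfg_σ01_VdefG, hol_defectCfg, (passes_sideB (d := d) hL fun _ => ⟨0, by omega⟩).2, zpow_zero, mul_one,
    val_expUnit, congr_fun Complex.exp_eq_exp_ℂ]
  congr 1
  rw [Complex.real_smul]
  push_cast
  ring

/-- `e^{is} ≠ 1` for `0 < s < 1`. [folklore] -/
private theorem exp_mul_I_ne_one {s : ℝ} (h0 : 0 < s) (h1 : s < 1) : Complex.exp ((s : ℂ) * Complex.I) ≠ 1 := by
  intro h
  obtain ⟨n, hn⟩ := Complex.exp_eq_one_iff.mp h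
  have him := congrArg Complex.im hn
  simp only [Complex.mul_im, Complex.I_re, Complex.I_im, Complex.ofReal_im, Complex.ofReal_re, Complex.mul_re,
    Complex.intCast_re, Complex.intCast_im, Complex.re_ofNat, Complex.im_ofNat, mul_zero, mul_one,
    sub_zero, zero_mul, add_zero] at him
  have hπ := Real.pi_gt_three
  rcases lt_trichotomy n 0 with hn0 | rfl | hn0
  · have : (n : ℝ) ≤ -1 := by exact_mod_cast Int.le_sub_one_of_lt hn0
    nlinarith
  · simp at him; linarith
  · have : (1 : ℝ) ≤ n := by exact_mod_cast hn0
    nlinarith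

/-- The transposed bond reads the ORIGINAL average at `⟨0, L e₀⟩`. [cite: Balaban1987RG1, (2.17) p.269 (bookkeeping)] -/
theorem permCfg_bavg_VdefG (L : ℕ) : permCfg (σ01 d) (bavg L (VdefG d)) 0 1 = bavg L (VdefG d) 0 0 := by
  have h0 : permSite (σ01 d) (0 : B7Prop1Explicit.Site (d + 2)) = 0 := by funext i; simp [permSite_apply]
  rw [permCfg_apply, h0]
  simp [σ01]

/-- Side B's average is not `1`: `0 < s ≤ 1∕2 < 2π`. [cite: Balaban1985Averaging, (42) p.23 (bookkeeping)] -/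
theorem val_bavg_permCfg_VdefG_ne_one {L : ℕ} (hL : 2 ≤ L) : ((bavg L (permCfg (σ01 d) (VdefG d)) 0 1 : ℂˣ) : ℂ) ≠ 1 := by
  rw [val_bavg_permCfg_VdefG hL]
  have h1M : (1 : ℝ) ≤ (Finset.univ.filter (MeetsB (d := d) L)).card := by exact_mod_cast one_le_card_meetsB (d := d) hL
  have hM : ((Finset.univ.filter (MeetsB (d := d) L)).card : ℝ) ≤ (L : ℝ) ^ (d + 2) := by exact_mod_cast card_meetsB_le (d := d)
  have hLp : (0 : ℝ) < (L : ℝ) ^ (d + 2) := by positivity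
  have hle : ((Finset.univ.filter (MeetsB (d := d) L)).card : ℝ) * ((L : ℝ) ^ (d + 2))⁻¹ ≤ 1 := by
    rw [← div_eq_mul_inv, div_le_one hLp]; exact hM
  refine exp_mul_I_ne_one ?_ ?_
  · have : (0 : ℝ) < ((L : ℝ) ^ (d + 2))⁻¹ := by positivity
    positivity
  · linarith

/-- The two sides of the equivariance identity DIFFER at `VdefG`, bond `⟨0, L e₁⟩` (`1` vs `e^{is}`). [cite: Balaban1987RG1, p.252] -/
theorem bavg_permCfg_ne_general {L : ℕ} (hL : 2 ≤ L) :
    bavg L (permCfg (σ01 d) (VdefG d)) 0 1 ≠ permCfg (σ01 d) (bavg L (VdefG d)) 0 1 := by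
  intro h1
  rw [permCfg_bavg_VdefG, bavg_VdefG hL] at h1
  exact val_bavg_permCfg_VdefG_ne_one (d := d) hL (by rw [h1, Units.val_one])

/-- **[Balaban1987RG1] p. 252 FOR THE TREE's (42), EVERY `d ≥ 2` AND `L ≥ 2` (KERNEL)**: Bałaban's block average (42) of
[Balaban1985Averaging] (`B7Prop1Explicit.bavg L`: corner blocks, one fixed tree-contour ordering) is NOT equivariant under the transposition
of the first two axes of `ℤ^{d+2}`, already for `U(1)`-valued configurations — «not symmetric with respect to lattice Euclidean
transformations», certified uniformly in the parameters. [cite: Balaban1987RG1, p.252] -/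
theorem not_permEquivariant_bavg_general {L : ℕ} (hL : 2 ≤ L) : ¬ PermEquivariantAt (G := ℂˣ) (d := d + 2) (bavg L) (σ01 d) :=
  fun h => bavg_permCfg_ne_general (d := d) hL (by rw [h (VdefG d)])

/-- **AT THE TREE's DIMENSION `d = 4`**: for every block size `L ≥ 2` — so for the `L` of every `T4Continuum.T4Family` (`L` odd, `L > 11`) —
(42) on `ℤ⁴` is not equivariant under the transposition of the first two axes. [cite: Balaban1987RG1, p.252] -/
theorem not_permEquivariant_bavg_dim4 {L : ℕ} (hL : 2 ≤ L) : ¬ PermEquivariantAt (G := ℂˣ) (d := 4) (bavg L) (σ01 2) :=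
  not_permEquivariant_bavg_general (d := 2) hL

end Witness

end Literature.MathematicalPhysics.QuantumFieldTheory.Balaban1983to89.B7Eq42NotEuclideanSymmetricGeneral

end
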